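import Literature.MathematicalPhysics.QuantumFieldTheory.Balaban1983to89.B7Prop3GeneralRotated
import Literature.MathematicalPhysics.QuantumFieldTheory.Balaban1983to89.B8Ineq132
import Summits.QuantumFields.BalabanUV.T4Continuum.Support.GaugeFieldPerturbation
import HarnessLib

/-!
# `UnitScaleTiltProp7CornerFrameLegsLetters` — LANE II (R-LEGS), brick letters for (R-LEGS-cov): THE POINTWISE ONE-STEP SPLIT OF THE CORNER-FRAME LEGS
# (conjugation Lipschitz letters, the straight covariant telescope, the shifted-word comparison of print's rotated sums `(R_{0,y}A)(Γ)`, and the one-step legs algebra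
# of ★routeR-w2's derivative recursion) — crux `MinimiserStabilityRegPr` (stmt-QuantumFields-19200), EX lane, hN06 LANE II (B4★)∕(QB)∕(QH1) supplier (R-LEGS);
# `--supports stmt-QuantumFields-19200 --as helper`, count-neutral

Cell `ym3-torus` (HUMAN RULING D-0037: YM₃ on T³ is ladder rung R3 — NOT d = 4, NOT infinite volume, NOT a mass gap, NOT the Clay problem), width seat `ym-ust-20520-w4` (g12), pen of the
curved row `rlegs` (px19 g6 SIGNATURE-0 1cfeb477; px15 g5 yielded 07:52Z).  THEOREMS ONLY (0 `def`, 0 `sorry`); nothing here claims (R-LEGS-cov), (QB), (QH1), (REC), `hN06`, EX or the crux.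

WHY.  By ✓`Prop7RLegsOfCovGrad.rlegs_of_covGradLegs` the displayed row `rlegs` follows from (R-LEGS-cov) — the coarse covariant gradient of the corner frames' linear response
`D_k = D(frameTw W · y)(0)` bounded by `Cr·ℓ·Σ‖∇^W A‖² + Cr′·e·ℓ⁻¹Σ‖A‖²`.  The response obeys ★routeR-w2's recursion (✓`Prop7CombFrameLinearResponseOfRegPr.fderiv_vcov_succ_apply_tsum_of_regPr`)
`D_{j+1}(z) = (Lᵈ)⁻¹ Σ_r [ tsum Ūʲ Y_j (L•z) (Γ_r) + R(Ūʲ(Γ_r))·D_j(L•z + r) ]` — nested covariant block means of the rotated tree-contour sums of the single-bar derivatives `Y_j`.  The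
legs mechanism of record (px19 g6 07:49:25Z (2); LOCATE №2 e299e056): at each level, the coarse covariant difference `D_{j+1}(z) − R(T)D_{j+1}(z + e_μ)` splits into (a) a transported
mean of `L·Lᵈ` level-`j` unit differences of `D_j`, (b) the source — the difference of the two blocks' rotated tree sums, telescoped into `L` covariant unit differences of `Y_j` per tree
bond —, and (c) CURVATURE defects `2‖g·s − T·g′‖·‖·‖` from comparing transports around rectangles.  THIS FILE is the per-site algebra of that split, over ANY normed ring, ANY background
`V₀` with values in the class `U1` (norm `≤ 1` with inverse), ANY rungs — every curvature quantity DISPLAYED as a letter (no Stokes here):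

* §1 ★`norm_conjR_sub_conjR_le` — `‖R(u)x − R(v)x‖ ≤ 2‖u − v‖‖x‖` on `U1` (over ✓`GaugeFieldPerturbation.norm_units_inv_sub_inv_le`; `R(u)R(v) = R(uv)` is lit ✓`B8Ineq132.conjR_conjR`).
* §2 ★`norm_sub_conjR_hol_replicate_le` — THE STRAIGHT COVARIANT TELESCOPE `‖X(y) − R(V₀([y → m steps e_μ]))X(y + m•e_μ)‖ ≤ Σ_{t<m} ‖X(y + t•e_μ) − R(V₀(y + t•e_μ, μ))X(y + (t+1)•e_μ)‖`.
* §3 `norm_tsum_le_asum` (`‖(R_{0,x}A)(Γ)‖ ≤ Σ_{b⊂Γ} a_b` for forward words), `asum_nonneg_of_forward`, ★★`norm_tsum_sub_conjR_tsum_shift_le` — THE SHIFTED-WORD COMPARISON: for a forward word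
  `Γ` from `x` and from `x + v` with rungs `ρ_y : y → y + v` in `U1`, `‖(R_{0,x}A)(Γ) − R(ρ_x)(R_{0,x+v}A)(Γ)‖ ≤ Σ_{b⊂Γ} G(b) + 2·(Σ_{b⊂Γ} δ(b))·(Σ_{b⊂Γ+v} a(b))` whenever bondwise
  `‖A(b) − R(ρ_{b₋})A(b + v)‖ ≤ G(b)` and the rung commutators `‖V₀(b)·ρ_{b₊} − ρ_{b₋}·V₀(b + v)‖ ≤ δ(b)` (the rectangle holonomy defects, DISPLAYED).
* §4 ★★`norm_legsStep_le` — THE ONE-STEP LEGS ALGEBRA: `‖c•Σ_r (S_r + R(g_r)D_r) − R(T)(c•Σ_r (S′_r + R(g′_r)D′_r))‖ ≤ |c|·Σ_r (‖S_r − R(T)S′_r‖ + ‖D_r − R(s_r)D′_r‖ + 2‖g_r s_r − T g′_r‖·‖D′_r‖)`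
  for `g g′ s T` in `U1` — (a)+(b)+(c) at one coarse site.
HONEST SCOPE.  Normed-ring algebra only ([folklore] letters around [Balaban1985Averaging] (56)–(58), (97)); the ℓ² summation over one period cell, the Stokes discharge of `δ`, the
gradient rows of the single-bar tower and the member knit are the NEXT bricks (LOCATE №2 (Br-4)–(Br-6)).  Rung R3; nothing of the crux ∕ the gap is claimed.

References: T. Bałaban, CMP 98 (1985) 17–51 [Balaban1985Averaging] ((9) p.18, (56)–(58) p.27, (97) p.32, (110)–(112) p.34, (160) p.42); CMP 99 (1985) 389–434
[Balaban1985BackgroundPropagators] ((3.14)–(3.15) p.393).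
-/

set_option autoImplicit false

noncomputable section

open scoped BigOperators

namespace Summit.QuantumFields.YangMills.Theorems.Prop7CornerFrameLegsLetters

open Literature.MathematicalPhysics.QuantumFieldTheory.Balaban1983to89
open B7Prop1Explicit (Site Letter e hol hol_cons hol_nil stepHol U1 mem_U1 stepHol_mem hol_mem asum asum_nil asum_cons stepA)
open B7Eq78Linearization (conjR conjR_apply conjR_add conjR_sub conjR_smul)
open B7Prop3GeneralRotated (tsum tsum_nil tsum_cons tstep norm_conjR_le)
open B8Ineq132 (conjR_conjR)
open Summit.QuantumFields.BalabanUV.T4Continuum.GaugeFieldPerturbation (norm_units_inv_sub_inv_le)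

variable {d : ℕ} {𝔸 : Type*} [NormedRing 𝔸] [NormOneClass 𝔸]

/-! ## §1 Conjugation letters on the class `U1` -/

/-- ★ **CONJUGATION IS `2`-LIPSCHITZ IN THE UNIT ON `U1`**: `‖R(u)x − R(v)x‖ ≤ 2‖u − v‖‖x‖` (`R(u)x − R(v)x = (u − v)xu⁻¹ + vx(u⁻¹ − v⁻¹)`). [folklore] -/
theorem norm_conjR_sub_conjR_le {u v : 𝔸ˣ} (hu : u ∈ U1 𝔸) (hv : v ∈ U1 𝔸) (x : 𝔸) :
    ‖conjR u x - conjR v x‖ ≤ 2 * ‖(u : 𝔸) - (v : 𝔸)‖ * ‖x‖ := by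
  obtain ⟨_, hu2⟩ := mem_U1.1 hu
  obtain ⟨hv1, _⟩ := mem_U1.1 hv
  have hid : conjR u x - conjR v x
      = ((u : 𝔸) - (v : 𝔸)) * x * ((u⁻¹ : 𝔸ˣ) : 𝔸) + (v : 𝔸) * x * (((u⁻¹ : 𝔸ˣ) : 𝔸) - ((v⁻¹ : 𝔸ˣ) : 𝔸)) := by
    rw [conjR_apply, conjR_apply]; noncomm_ring
  rw [hid]
  have h1 : ‖((u : 𝔸) - (v : 𝔸)) * x * ((u⁻¹ : 𝔸ˣ) : 𝔸)‖ ≤ ‖(u : 𝔸) - (v : 𝔸)‖ * ‖x‖ := by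
    calc _ ≤ ‖(u : 𝔸) - (v : 𝔸)‖ * ‖x‖ * ‖((u⁻¹ : 𝔸ˣ) : 𝔸)‖ :=
          (norm_mul_le _ _).trans (mul_le_mul_of_nonneg_right (norm_mul_le _ _) (norm_nonneg _))
      _ ≤ ‖(u : 𝔸) - (v : 𝔸)‖ * ‖x‖ * 1 := by gcongr
      _ = _ := mul_one _
  have h2 : ‖(v : 𝔸) * x * (((u⁻¹ : 𝔸ˣ) : 𝔸) - ((v⁻¹ : 𝔸ˣ) : 𝔸))‖ ≤ ‖(u : 𝔸) - (v : 𝔸)‖ * ‖x‖ := by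
    calc _ ≤ ‖(v : 𝔸)‖ * ‖x‖ * ‖((u⁻¹ : 𝔸ˣ) : 𝔸) - ((v⁻¹ : 𝔸ˣ) : 𝔸)‖ :=
          (norm_mul_le _ _).trans (mul_le_mul_of_nonneg_right (norm_mul_le _ _) (norm_nonneg _))
      _ ≤ 1 * ‖x‖ * ‖(u : 𝔸) - (v : 𝔸)‖ := by gcongr; exact norm_units_inv_sub_inv_le hu hv
      _ = _ := by ring
  calc _ ≤ ‖((u : 𝔸) - (v : 𝔸)) * x * ((u⁻¹ : 𝔸ˣ) : 𝔸)‖ + ‖(v : 𝔸) * x * (((u⁻¹ : 𝔸ˣ) : 𝔸) - ((v⁻¹ : 𝔸ˣ) : 𝔸))‖ := norm_add_le _ _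
    _ ≤ _ := by linarith

/-! ## §2 The straight covariant telescope -/

/-- ★ **THE STRAIGHT COVARIANT TELESCOPE**: for a site function `X`, a `U1`-valued background `V₀`, a site `y`, a direction `μ` and `m` steps,
`‖X(y) − R(V₀(y; m steps e_μ))X(y + m•e_μ)‖ ≤ Σ_{t<m} ‖X(y + t•e_μ) − R(V₀(y + t•e_μ, μ))X(y + (t+1)•e_μ)‖` — the covariant difference across `m` bonds is at most the sum of the `m` unit
covariant differences (conjugation by `U1` does not increase norms). [cite: Balaban1985Averaging, (9) p.18, (56)-(57) p.27] -/
theorem norm_sub_conjR_hol_replicate_le {V₀ : Site d → Fin d → 𝔸ˣ} (hV₀ : ∀ x κ, V₀ x κ ∈ U1 𝔸) (X : Site d → 𝔸) (μ : Fin d) :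
    ∀ (m : ℕ) (y : Site d),
      ‖X y - conjR (hol V₀ y (List.replicate m (μ, true))) (X (y + (m : ℤ) • e μ))‖
        ≤ ∑ t ∈ Finset.range m, ‖X (y + (t : ℤ) • e μ) - conjR (V₀ (y + (t : ℤ) • e μ) μ) (X (y + ((t : ℤ) + 1) • e μ))‖
  | 0, y => by simp [hol_nil, conjR_apply]
  | m + 1, y => by
    rw [List.replicate_succ, hol_cons, Finset.sum_range_succ', Nat.cast_zero, zero_smul, add_zero]
    have hstep : stepHol V₀ y (μ, true) = V₀ y μ := rfl
    have hvec : (Letter.vec ((μ, true) : Letter d)) = e μ := rfl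
    rw [hstep, hvec]
    -- split at the first bond
    have ih := norm_sub_conjR_hol_replicate_le hV₀ X μ m (y + e μ)
    set h := hol V₀ (y + e μ) (List.replicate m (μ, true)) with hh
    have hsplit : X y - conjR (V₀ y μ * h) (X (y + ((m + 1 : ℕ) : ℤ) • e μ))
        = (X y - conjR (V₀ y μ) (X (y + (1 : ℤ) • e μ)))
          + conjR (V₀ y μ) (X (y + e μ) - conjR h (X (y + e μ + (m : ℤ) • e μ))) := by
      rw [conjR_sub, conjR_conjR, one_smul, Nat.cast_succ, add_smul, one_smul, ← add_assoc, add_comm (y + (m : ℤ) • e μ), show y + e μ + (m : ℤ) • e μ = y + (m : ℤ) • e μ + e μ by abel]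
      abel
    rw [hsplit]
    refine (norm_add_le _ _).trans ?_
    rw [add_comm]
    refine add_le_add ?_ (by rw [zero_add])
    refine (norm_conjR_le (hV₀ y μ) _).trans (ih.trans (le_of_eq ?_))
    refine Finset.sum_congr rfl fun t _ => ?_
    rw [Nat.cast_succ, show y + e μ + (t : ℤ) • e μ = y + ((t : ℤ) + 1) • e μ by rw [add_smul, one_smul]; abel,
      show y + e μ + ((t : ℤ) + 1) • e μ = y + ((t : ℤ) + 1 + 1) • e μ by rw [add_smul ((t:ℤ) + 1), one_smul]; abel]

/-! ## §3 Print's rotated sums along a forward word: size, and the shifted-word comparison -/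

/-- For a FORWARD word (every letter positively oriented) the rotated sum is bounded by the plain sum of any bondwise majorant: `‖(R_{0,x}A)(Γ)‖ ≤ Σ_{b⊂Γ} a(b)` whenever `‖A(b)‖ ≤ a(b)`
(`V₀` in `U1`, rotations do not increase norms). [cite: Balaban1985Averaging, (58) p.27, (126) p.36] -/
theorem norm_tsum_le_asum {V₀ : Site d → Fin d → 𝔸ˣ} (hV₀ : ∀ x κ, V₀ x κ ∈ U1 𝔸) {A : Site d → Fin d → 𝔸} {a : Site d → Fin d → ℝ}
    (ha : ∀ x κ, ‖A x κ‖ ≤ a x κ) :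
    ∀ (x : Site d) (w : List (Letter d)), (∀ l ∈ w, l.2 = true) → ‖tsum V₀ A x w‖ ≤ asum a x w
  | x, [], _ => by simp
  | x, l :: w, hw => by
    have hl : l.2 = true := hw l (by simp)
    have hw' : ∀ l' ∈ w, l'.2 = true := fun l' hl' => hw l' (by simp [hl'])
    rw [tsum_cons, asum_cons]
    refine (norm_add_le _ _).trans (add_le_add ?_ ?_)
    · have : tstep V₀ A x l = A x l.1 := by unfold tstep; rw [if_pos hl]
      have hs : stepA a x l = a x l.1 := by unfold stepA; rw [if_pos hl]
      rw [this, hs]; exact ha _ _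
    · exact (norm_conjR_le (stepHol_mem hV₀ x l) _).trans (norm_tsum_le_asum hV₀ ha _ w hw')

omit [NormOneClass 𝔸] in
/-- The plain sum of a nonnegative bond function along a forward word is nonnegative. [folklore] -/
theorem asum_nonneg_of_forward {a : Site d → Fin d → ℝ} (ha : ∀ x κ, 0 ≤ a x κ) :
    ∀ (x : Site d) (w : List (Letter d)), (∀ l ∈ w, l.2 = true) → 0 ≤ asum a x w
  | x, [], _ => by simp
  | x, l :: w, hw => by
    have hl : l.2 = true := hw l (by simp)
    have hw' : ∀ l' ∈ w, l'.2 = true := fun l' hl' => hw l' (by simp [hl'])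
    rw [asum_cons]
    have hs : stepA a x l = a x l.1 := by unfold stepA; rw [if_pos hl]
    rw [hs]
    exact add_nonneg (ha _ _) (asum_nonneg_of_forward ha _ w hw')

/-- ★★ **THE SHIFTED-WORD COMPARISON OF THE ROTATED SUMS.**  `V₀` a `U1`-valued background, `A` a bond field with bondwise majorant `a ≥ 0`, `v` a shift vector, `ρ_y : 𝔸ˣ` rungs in `U1`
(thought of as transports `y → y + v`), and two DISPLAYED bond letters along the direction of each forward letter: `G(y, κ) ≥ ‖A(y,κ) − R(ρ_y)A(y + v, κ)‖` (the shifted covariant difference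
of `A`) and `δ(y, κ) ≥ ‖V₀(y,κ)·ρ_{y+e_κ} − ρ_y·V₀(y + v, κ)‖` (the rectangle commutator of background and rungs).  Then for every FORWARD word `Γ` from `x`:
`‖(R_{0,x}A)(Γ) − R(ρ_x)(R_{0,x+v}A)(Γ)‖ ≤ Σ_{b⊂Γ} G(b) + 2·(Σ_{b⊂Γ} δ(b))·(Σ_{b⊂Γ from x+v} a(b))`.
Induction on `Γ` along (58): the first letter gives `G`, the transported tail gives the induction hypothesis (rotations contract), and exchanging `R(V₀(b))R(ρ_{b₊})` for `R(ρ_{b₋})R(V₀(b+v))`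
on the tail costs `2δ(b)·‖tail‖ ≤ 2δ(b)·Σ a` (§1 + `norm_tsum_le_asum`). [cite: Balaban1985Averaging, (58) p.27, (56)-(57) p.27, (111) p.34] -/
theorem norm_tsum_sub_conjR_tsum_shift_le {V₀ : Site d → Fin d → 𝔸ˣ} (hV₀ : ∀ x κ, V₀ x κ ∈ U1 𝔸) (A : Site d → Fin d → 𝔸)
    {a : Site d → Fin d → ℝ} (ha0 : ∀ x κ, 0 ≤ a x κ) (ha : ∀ x κ, ‖A x κ‖ ≤ a x κ) (v : Site d)
    {ρ : Site d → 𝔸ˣ} (hρ : ∀ y, ρ y ∈ U1 𝔸)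
    {G δ : Site d → Fin d → ℝ} (hδ0 : ∀ y κ, 0 ≤ δ y κ)
    (hG : ∀ y κ, ‖A y κ - conjR (ρ y) (A (y + v) κ)‖ ≤ G y κ)
    (hδ : ∀ y κ, ‖(V₀ y κ : 𝔸) * (ρ (y + e κ) : 𝔸) - (ρ y : 𝔸) * (V₀ (y + v) κ : 𝔸)‖ ≤ δ y κ) :
    ∀ (x : Site d) (w : List (Letter d)), (∀ l ∈ w, l.2 = true) →
      ‖tsum V₀ A x w - conjR (ρ x) (tsum V₀ A (x + v) w)‖ ≤ asum G x w + 2 * asum δ x w * asum a (x + v) w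
  | x, [], _ => by simp [conjR_apply]
  | x, l :: w, hw => by
    have hl : l.2 = true := hw l (by simp)
    have hw' : ∀ l' ∈ w, l'.2 = true := fun l' hl' => hw l' (by simp [hl'])
    obtain ⟨κ, b⟩ := l
    simp only at hl
    subst hl
    have hvec : (Letter.vec ((κ, true) : Letter d)) = e κ := rfl
    have hstep : ∀ y, stepHol V₀ y (κ, true) = V₀ y κ := fun y => rfl
    have htstep : ∀ y, tstep V₀ A y (κ, true) = A y κ := fun y => by unfold tstep; simp
    have hsA : ∀ (f : Site d → Fin d → ℝ) y, stepA f y (κ, true) = f y κ := fun f y => by unfold stepA; simp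
    rw [tsum_cons, tsum_cons, asum_cons, asum_cons, asum_cons, htstep, htstep, hstep, hstep, hvec, hsA, hsA, hsA]
    -- the tail words
    set R₁ := tsum V₀ A (x + e κ) w with hR₁
    set R₂ := tsum V₀ A (x + v + e κ) w with hR₂
    have ih := norm_tsum_sub_conjR_tsum_shift_le hV₀ A ha0 ha v hρ hδ0 hG hδ (x + e κ) w hw'
    rw [show x + e κ + v = x + v + e κ by abel] at ih
    -- algebra: split into first letter + transported IH + commutator defect
    have hsplit : A x κ + conjR (V₀ x κ) R₁ - conjR (ρ x) (A (x + v) κ + conjR (V₀ (x + v) κ) R₂)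
        = (A x κ - conjR (ρ x) (A (x + v) κ))
          + conjR (V₀ x κ) (R₁ - conjR (ρ (x + e κ)) R₂)
          + (conjR (V₀ x κ * ρ (x + e κ)) R₂ - conjR (ρ x * V₀ (x + v) κ) R₂) := by
      rw [conjR_add, conjR_sub, conjR_conjR, conjR_conjR]; abel
    rw [hsplit]
    have hR₂ : ‖R₂‖ ≤ asum a (x + v + e κ) w := norm_tsum_le_asum hV₀ ha _ w hw'
    have h1 := hG x κ
    have h2 : ‖conjR (V₀ x κ) (R₁ - conjR (ρ (x + e κ)) R₂)‖ ≤ asum G (x + e κ) w + 2 * asum δ (x + e κ) w * asum a (x + v + e κ) w :=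
      (norm_conjR_le (hV₀ x κ) _).trans ih
    have h3 : ‖conjR (V₀ x κ * ρ (x + e κ)) R₂ - conjR (ρ x * V₀ (x + v) κ) R₂‖ ≤ 2 * δ x κ * asum a (x + v + e κ) w := by
      refine (norm_conjR_sub_conjR_le (Subgroup.mul_mem _ (hV₀ x κ) (hρ _)) (Subgroup.mul_mem _ (hρ x) (hV₀ _ κ)) R₂).trans ?_
      rw [Units.val_mul, Units.val_mul]
      have := hδ x κ
      have hδx := hδ0 x κ
      nlinarith [norm_nonneg R₂, norm_nonneg ((V₀ x κ : 𝔸) * (ρ (x + e κ) : 𝔸) - (ρ x : 𝔸) * (V₀ (x + v) κ : 𝔸))]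
    have ha1 : 0 ≤ a (x + v) κ := ha0 _ _
    have hGw : 0 ≤ asum δ (x + e κ) w := asum_nonneg_of_forward hδ0 _ w hw'
    have haw : 0 ≤ asum a (x + v + e κ) w := asum_nonneg_of_forward ha0 _ w hw'
    calc _ ≤ ‖A x κ - conjR (ρ x) (A (x + v) κ)‖ + ‖conjR (V₀ x κ) (R₁ - conjR (ρ (x + e κ)) R₂)‖
          + ‖conjR (V₀ x κ * ρ (x + e κ)) R₂ - conjR (ρ x * V₀ (x + v) κ) R₂‖ := norm_add₃_le
      _ ≤ G x κ + (asum G (x + e κ) w + 2 * asum δ (x + e κ) w * asum a (x + v + e κ) w) + 2 * δ x κ * asum a (x + v + e κ) w := by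
          linarith
      _ ≤ G x κ + asum G (x + e κ) w + 2 * (δ x κ + asum δ (x + e κ) w) * (a (x + v) κ + asum a (x + v + e κ) w) := by
          nlinarith [hδ0 x κ, mul_nonneg hGw ha1, mul_nonneg (hδ0 x κ) ha1]

/-! ## §4 The one-step legs algebra -/

section Step

variable [NormedAlgebra ℂ 𝔸]

/-- ★★ **THE ONE-STEP LEGS ALGEBRA** at one coarse site: with the (complex) block-mean weight `c` (`= (Lᵈ)⁻¹` in ★routeR-w2's recursion), rotated tree sums `S_r`, `S′_r`, tree transports
`g_r`, `g′_r`, straight rungs `s_r`, the next-level transporter `T` (all units in `U1`) and old-level values `D_r`, `D′_r`,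
`‖c•Σ_r (S_r + R(g_r)D_r) − R(T)(c•Σ_r (S′_r + R(g′_r)D′_r))‖ ≤ ‖c‖·Σ_r ( ‖S_r − R(T)S′_r‖ + ‖D_r − R(s_r)D′_r‖ + 2‖g_r·s_r − T·g′_r‖·‖D′_r‖ )` —
the source (b), the transported old differences (a) and the rectangle defects (c) of the legs mechanism, read off ★routeR-w2's derivative recursion (97)′.
[cite: Balaban1985Averaging, (97) p.32, (56)-(58) p.27, (160) p.42] -/
theorem norm_legsStep_le {ι : Type*} [Fintype ι] (c : ℂ) (S S' D D' : ι → 𝔸) {g g' s : ι → 𝔸ˣ} {T : 𝔸ˣ}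
    (hg : ∀ r, g r ∈ U1 𝔸) (hg' : ∀ r, g' r ∈ U1 𝔸) (hs : ∀ r, s r ∈ U1 𝔸) (hT : T ∈ U1 𝔸) :
    ‖c • ∑ r, (S r + conjR (g r) (D r)) - conjR T (c • ∑ r, (S' r + conjR (g' r) (D' r)))‖
      ≤ ‖c‖ * ∑ r, (‖S r - conjR T (S' r)‖ + ‖D r - conjR (s r) (D' r)‖ + 2 * ‖(g r : 𝔸) * (s r : 𝔸) - (T : 𝔸) * (g' r : 𝔸)‖ * ‖D' r‖) := by
  -- `R(T)` is linear
  have hlin : conjR T (c • ∑ r, (S' r + conjR (g' r) (D' r))) = c • ∑ r, (conjR T (S' r) + conjR (T * g' r) (D' r)) := by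
    rw [conjR_smul]
    congr 1
    rw [conjR_apply, Finset.mul_sum, Finset.sum_mul]
    refine Finset.sum_congr rfl fun r _ => ?_
    rw [← conjR_apply, conjR_add, conjR_conjR]
  rw [hlin, ← smul_sub, ← Finset.sum_sub_distrib, norm_smul]
  refine mul_le_mul_of_nonneg_left ((norm_sum_le _ _).trans (Finset.sum_le_sum fun r _ => ?_)) (norm_nonneg c)
  -- per block point
  have hsplit : S r + conjR (g r) (D r) - (conjR T (S' r) + conjR (T * g' r) (D' r))
      = (S r - conjR T (S' r)) + conjR (g r) (D r - conjR (s r) (D' r)) + (conjR (g r * s r) (D' r) - conjR (T * g' r) (D' r)) := by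
    rw [conjR_sub, conjR_conjR]; abel
  rw [hsplit]
  calc _ ≤ ‖S r - conjR T (S' r)‖ + ‖conjR (g r) (D r - conjR (s r) (D' r))‖ + ‖conjR (g r * s r) (D' r) - conjR (T * g' r) (D' r)‖ := norm_add₃_le
    _ ≤ ‖S r - conjR T (S' r)‖ + ‖D r - conjR (s r) (D' r)‖ + 2 * ‖(g r : 𝔸) * (s r : 𝔸) - (T : 𝔸) * (g' r : 𝔸)‖ * ‖D' r‖ := by
        gcongr
        · exact norm_conjR_le (hg r) _
        · have := norm_conjR_sub_conjR_le (Subgroup.mul_mem _ (hg r) (hs r)) (Subgroup.mul_mem _ hT (hg' r)) (D' r)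
          rwa [Units.val_mul, Units.val_mul] at this

end Step

end Summit.QuantumFields.YangMills.Theorems.Prop7CornerFrameLegsLetters

end
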